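import Summits.AtomisticToContinuum.Crystallization.Theorems.ExcessDecayLiouvilleHcpLiouvilleGeometry
import Summits.AtomisticToContinuum.Crystallization.Theorems.ExcessDecayLiouvilleHcpLiouvilleAnchorNewton

/-!
# `ExcessDecayLiouville.HcpLiouville` (stmt-AtomisticToContinuum-9332): vocabulary of the blow-down level 2

Route `ExcessDecayLiouville` (sub-problem `Crystallization`), crux `HcpLiouville` (rank 3), line `Sketch`
(Cruxes/HcpLiouville/Lines/Sketch.lean), skeleton v4.  Level 1 of the line (displacement form, relaxed anchor,
Caccioppoli under ray-secant coercivity) is landed; its level 2 by period differences needed tangent coercivity on the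
whole `1/40`-box, which is certified false (item evidence kit j017763).  Skeleton v4 replaces level 2 by a
QUANTITATIVE BLOW-DOWN (improvement of flatness from `R = ∞`, where boundedness of the displacement is smallness):
with `v` the displacement of the equilibrium from the relaxed anchor two-lattice `S*` and `L` the force-constant
operator of `S*`, force balance reads `L v = −div N(Dv)` EXACTLY (`N` = Taylor remainder of the pair force); the
truncated remainder is solved away by `z₁ := L⁻¹ div(trunc N)` with the LATTICE bound `‖z₁‖_{ℓ²} ≤ C·‖trunc N‖_{ℓ¹,1}`
(Fourier on the two-lattice: `∫_{T³} |k|⁻² dk < ∞`), `z₂ := v + z₁` is exactly `L`-harmonic on the ball, and the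
linear interior estimate improves the mean-square oscillation by `θ²`; the error is of relative size
`C·(osc)·R^{-1/2} → 0`, so no unit-scale smallness is ever used.  This file only NAMES the objects and the four
analytic interfaces of that scheme (all over the tree's `Sites₀ / nnForm / hessForm / forceConst /
LevelOne.vField` vocabulary), so that the stubs of the skeleton can be landed as `--supports` helpers with literally
matching signatures:

* `Blowdown.oscAt S v c r m` — `Σ_{s ∈ S ∩ B_r(c)} ‖v s − m‖²`, squared oscillation about the constant `m`;
* `Blowdown.nnEnergy S v c r` — the nearest-neighbour (`≤ 11/10`) strain energy of `v` on `S ∩ B_r(c)`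
  (the double sum of `GrowthBound`);
* `Blowdown.PSIneq κ t A` — the `PhononStability` inequality at ONE datum with constant `κ`;
* `Blowdown.ljForce`, `Blowdown.ljRemainder e d = F(e+d) − F(e) − K(e)d`, `Blowdown.truncRemainder`;
* `Blowdown.IsHarmonicOn S z c R` — the rows `Σ_q K(p−q)(z p − z q)` vanish (`HasSum`) for `p ∈ S ∩ B_R(c)`;
* the interfaces `Blowdown.CaccioppoliProp ρ C` (nonlinear Caccioppoli with a common constant subtracted),
  `Blowdown.RemainderProp C` (the exact linearised equation and the weighted `ℓ¹` bound of the truncated remainder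
  by the strain energy), `Blowdown.GreenProp κ C` (`L⁻¹ div : ℓ¹,1 → ℓ²` on an admissible two-lattice satisfying
  `PSIneq κ`), `Blowdown.InteriorProp κ C` (oscillation decay of `L`-harmonic fields), and the output
  `Blowdown.ImprovementProp θ R₀ K S v` (one step of the excess-decay iteration, normalised, outer radius `16R`).

All predicates carry parameters (route-internal bookkeeping, not literature facts); everything is `[folklore]`;
nothing here closes an item.
-/

noncomputable section

namespace Summit.AtomisticToContinuum.Crystallization.Theorems.ExcessDecayLiouville

open scoped BigOperators Topology Classical InnerProductSpace
open Literature.MathematicalPhysics.StatisticalMechanics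
open Summit.AtomisticToContinuum.Crystallization.Theorems.PhononStabilityNegative

namespace Blowdown

/-! ### Scalar functionals of a field on a site set -/

/-- **Squared oscillation about a constant**: `Σ_{s ∈ S, dist s c ≤ r} ‖v s − m‖²` (a finite sum on the
two-lattice; `tsum` junk-free there). [folklore] -/
def oscAt (S : Set (EuclideanSpace ℝ (Fin 3))) (v : EuclideanSpace ℝ (Fin 3) → EuclideanSpace ℝ (Fin 3))
    (c : EuclideanSpace ℝ (Fin 3)) (r : ℝ) (m : EuclideanSpace ℝ (Fin 3)) : ℝ :=
  ∑' p : {s : EuclideanSpace ℝ (Fin 3) // s ∈ S ∧ dist s c ≤ r}, ‖v p - m‖ ^ 2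

/-- **Nearest-neighbour strain energy on a ball**: the ordered-pair sum of `‖v p − v q‖²` over `p ∈ S ∩ B_r(c)`
and `q ∈ S` with `dist p q ≤ 11/10` (the double sum of `GrowthBound`). [folklore] -/
def nnEnergy (S : Set (EuclideanSpace ℝ (Fin 3))) (v : EuclideanSpace ℝ (Fin 3) → EuclideanSpace ℝ (Fin 3))
    (c : EuclideanSpace ℝ (Fin 3)) (r : ℝ) : ℝ :=
  ∑' p : {s : EuclideanSpace ℝ (Fin 3) // s ∈ S ∧ dist s c ≤ r}, ∑' q : S,
    if dist (p : EuclideanSpace ℝ (Fin 3)) q ≤ 11 / 10 then ‖v p - v q‖ ^ 2 else 0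

/-- **The harmonic-stability inequality at one datum** with constant `κ`: the inner statement of
`PhononStability` for the datum `(t, A)` (`κ · nnForm ≤ ½ · hessForm` on finitely supported fields on the sites).
[folklore] -/
def PSIneq (κ : ℝ) (t : Fin 2 → EuclideanSpace ℝ (Fin 3))
    (A : EuclideanSpace ℝ (Fin 3) →L[ℝ] EuclideanSpace ℝ (Fin 3)) : Prop :=
  ∀ u : EuclideanSpace ℝ (Fin 3) → EuclideanSpace ℝ (Fin 3), (Function.support u).Finite →
    Function.support u ⊆ Sites₀ t A → κ * nnForm t A u ≤ hessForm t A u / 2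

/-! ### The pair force, its linearisation remainder, the linear operator -/

/-- **The Lennard-Jones pair force** `F(e) = (V′(|e|)/|e|)·e`. [folklore] -/
def ljForce (e : EuclideanSpace ℝ (Fin 3)) : EuclideanSpace ℝ (Fin 3) :=
  (deriv lennardJones ‖e‖ / ‖e‖) • e

/-- **Taylor remainder of the pair force** at the bond `e` in the direction `d`:
`N(e, d) = F(e + d) − F(e) − K(e) d` (`K = forceConst`, the differential of `F`). [folklore] -/
def ljRemainder (e d : EuclideanSpace ℝ (Fin 3)) : EuclideanSpace ℝ (Fin 3) :=
  ljForce (e + d) - ljForce e - forceConst e d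

/-- **Truncated remainder bond field** of the field `v` at the ball `B_R(c)`: `N(p − q, v p − v q)` if `p` or `q`
lies in the closed ball, `0` otherwise (antisymmetric in `(p, q)` because `N(−e, −d) = −N(e, d)`). [folklore] -/
def truncRemainder (v : EuclideanSpace ℝ (Fin 3) → EuclideanSpace ℝ (Fin 3)) (c : EuclideanSpace ℝ (Fin 3))
    (R : ℝ) (p q : EuclideanSpace ℝ (Fin 3)) : EuclideanSpace ℝ (Fin 3) :=
  if dist p c ≤ R ∨ dist q c ≤ R then ljRemainder (p - q) (v p - v q) else 0

/-- **`L`-harmonicity on a ball**: for every site `p ∈ S` with `dist p c ≤ R` the row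
`Σ_{q ∈ S} K(p − q)(z p − z q)` of the force-constant operator of `S` has sum `0` (`HasSum` form; the diagonal
term is `0` since `K(0) = 0`). [folklore] -/
def IsHarmonicOn (S : Set (EuclideanSpace ℝ (Fin 3))) (z : EuclideanSpace ℝ (Fin 3) → EuclideanSpace ℝ (Fin 3))
    (c : EuclideanSpace ℝ (Fin 3)) (R : ℝ) : Prop :=
  ∀ p : S, dist (p : EuclideanSpace ℝ (Fin 3)) c ≤ R →
    HasSum (fun q : S => forceConst ((p : EuclideanSpace ℝ (Fin 3)) - q) (z p - z q)) 0

/-! ### The four analytic interfaces of the blow-down and its output -/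

/-- **Nonlinear Caccioppoli inequality with a common constant** (interface; constant `C`, anchor radius `ρ`):
for an admissible hcp-like datum `(t, A)`, an equilibrium `X` in displacement form `u`, a relaxed anchor `τ`
(`‖τ‖ ≤ ρ`, anchored datum hcp-like, anchored sites in force balance) and `v = LevelOne.vField t A τ u` the
displacement seen from the anchored sites `S*`, for every centre `c`, radius `R ≥ 1` and constant `‖m‖ ≤ 1`:
`nnEnergy S* v c R ≤ C · (R⁻² · oscAt S* v c (4R) m + R⁻²)`. [folklore] -/
def CaccioppoliProp (ρ C : ℝ) : Prop :=
  ∀ (X : Set (EuclideanSpace ℝ (Fin 3))) (t : Fin 2 → EuclideanSpace ℝ (Fin 3))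
    (A : EuclideanSpace ℝ (Fin 3) →L[ℝ] EuclideanSpace ℝ (Fin 3))
    (u : EuclideanSpace ℝ (Fin 3) → EuclideanSpace ℝ (Fin 3)) (τ : EuclideanSpace ℝ (Fin 3)),
    Adm₀ A → Inner₀ t A → Equil₀ X → IsDisplacement X t A u → ‖τ‖ ≤ ρ →
    Inner₀ (anchorDatum t τ) A → Equil₀ (Sites₀ (anchorDatum t τ) A) →
    ∀ (c : EuclideanSpace ℝ (Fin 3)) (R : ℝ) (m : EuclideanSpace ℝ (Fin 3)), 1 ≤ R → ‖m‖ ≤ 1 →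
      nnEnergy (Sites₀ (anchorDatum t τ) A) (LevelOne.vField t A τ u) c R ≤
        C * ((R⁻¹) ^ 2 * oscAt (Sites₀ (anchorDatum t τ) A) (LevelOne.vField t A τ u) c (4 * R) m + (R⁻¹) ^ 2)

/-- **The linearised equation and the remainder bound** (interface; constant `C`): in the setting of
`CaccioppoliProp` (with `‖τ‖ ≤ 1/20`), (i) force balance of `X` minus force balance of the anchored sites `S*` is,
row by row, `Σ_q (K(p − q)(v p − v q) + N(p − q, v p − v q)) = 0` (`HasSum`); (ii) for every centre `c` and
`R ≥ 1` the truncated remainder is absolutely summable with the weight `1 + dist` and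
`Σ_{p,q ∈ S*} ‖truncRemainder v c R p q‖ (1 + dist p q) ≤ C · (nnEnergy S* v c (4R) + R⁻²)` (path bounds for
the bonds of length `≤ R`, the crude bound `‖Dv‖ ≤ 3/20` and the `r⁻⁹` decay beyond). [folklore] -/
def RemainderProp (C : ℝ) : Prop :=
  ∀ (X : Set (EuclideanSpace ℝ (Fin 3))) (t : Fin 2 → EuclideanSpace ℝ (Fin 3))
    (A : EuclideanSpace ℝ (Fin 3) →L[ℝ] EuclideanSpace ℝ (Fin 3))
    (u : EuclideanSpace ℝ (Fin 3) → EuclideanSpace ℝ (Fin 3)) (τ : EuclideanSpace ℝ (Fin 3)),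
    Adm₀ A → Inner₀ t A → Equil₀ X → IsDisplacement X t A u → ‖τ‖ ≤ 1 / 20 →
    Inner₀ (anchorDatum t τ) A → Equil₀ (Sites₀ (anchorDatum t τ) A) →
    (∀ p : Sites₀ (anchorDatum t τ) A,
      HasSum (fun q : Sites₀ (anchorDatum t τ) A =>
        forceConst ((p : EuclideanSpace ℝ (Fin 3)) - q) (LevelOne.vField t A τ u p - LevelOne.vField t A τ u q) +
          ljRemainder ((p : EuclideanSpace ℝ (Fin 3)) - q) (LevelOne.vField t A τ u p - LevelOne.vField t A τ u q)) 0) ∧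
    ∀ (c : EuclideanSpace ℝ (Fin 3)) (R : ℝ), 1 ≤ R →
      Summable (fun pq : Sites₀ (anchorDatum t τ) A × Sites₀ (anchorDatum t τ) A =>
        ‖truncRemainder (LevelOne.vField t A τ u) c R pq.1 pq.2‖ *
          (1 + dist (pq.1 : EuclideanSpace ℝ (Fin 3)) pq.2)) ∧
      (∑' pq : Sites₀ (anchorDatum t τ) A × Sites₀ (anchorDatum t τ) A,
        ‖truncRemainder (LevelOne.vField t A τ u) c R pq.1 pq.2‖ *
          (1 + dist (pq.1 : EuclideanSpace ℝ (Fin 3)) pq.2)) ≤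
        C * (nnEnergy (Sites₀ (anchorDatum t τ) A) (LevelOne.vField t A τ u) c (4 * R) + (R⁻¹) ^ 2)

/-- **The lattice Green's operator `L⁻¹ div` is `ℓ¹,1 → ℓ²`** (interface; stability constant `κ`, constant `C`):
on the sites `S` of an admissible hcp-like datum satisfying `PSIneq κ`, every antisymmetric bond field `M` with
`Σ_{p,q ∈ S} ‖M p q‖ (1 + dist p q) < ∞` is the row-divergence of the force-constant operator applied to a
square-summable field `z` (`Σ_q K(p − q)(z p − z q) = Σ_q M p q`, `HasSum`), with
`Σ_p ‖z p‖² ≤ C · (Σ_{p,q} ‖M p q‖ (1 + dist p q))²` (Fourier: `‖L̂(k)⁻¹‖ ≲ |k|⁻²`, `|(div M)^(k)| ≲ |k|` on the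
acoustic part, `∫_{T³} |k|⁻² < ∞`). [folklore] -/
def GreenProp (κ C : ℝ) : Prop :=
  ∀ (t : Fin 2 → EuclideanSpace ℝ (Fin 3)) (A : EuclideanSpace ℝ (Fin 3) →L[ℝ] EuclideanSpace ℝ (Fin 3)),
    Adm₀ A → Inner₀ t A → PSIneq κ t A →
    ∀ M : EuclideanSpace ℝ (Fin 3) → EuclideanSpace ℝ (Fin 3) → EuclideanSpace ℝ (Fin 3),
      (∀ p q : EuclideanSpace ℝ (Fin 3), M q p = -M p q) →
      Summable (fun pq : Sites₀ t A × Sites₀ t A =>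
        ‖M pq.1 pq.2‖ * (1 + dist (pq.1 : EuclideanSpace ℝ (Fin 3)) pq.2)) →
      ∃ z : EuclideanSpace ℝ (Fin 3) → EuclideanSpace ℝ (Fin 3),
        (∀ p : Sites₀ t A, HasSum (fun q : Sites₀ t A =>
          forceConst ((p : EuclideanSpace ℝ (Fin 3)) - q) (z p - z q)) (∑' q : Sites₀ t A, M p q)) ∧
        Summable (fun p : Sites₀ t A => ‖z p‖ ^ 2) ∧
        (∑' p : Sites₀ t A, ‖z p‖ ^ 2) ≤
          C * (∑' pq : Sites₀ t A × Sites₀ t A,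
            ‖M pq.1 pq.2‖ * (1 + dist (pq.1 : EuclideanSpace ℝ (Fin 3)) pq.2)) ^ 2

/-- **Interior oscillation decay for `L`-harmonic fields** (interface; stability constant `κ`, constant `C`): on
the sites `S` of an admissible hcp-like datum satisfying `PSIneq κ`, let `z` be `L`-harmonic on `B_R(c)`
(`R ≥ 16`) and let `z − m = a + b` off the constant `m` with `‖a‖ ≤ Y₀` pointwise on `S` and `Σ_S ‖b‖² ≤ Y₂²`
(needed only for the far-field tails of the infinite-range operator); then for `1 ≤ r ≤ R/16` some constant `m'`
has `oscAt S z c r m' ≤ C · ((r/R)⁵ · oscAt S z c R m + r⁵ · (Y₀² R⁻⁸ + Y₂² R⁻¹¹))` (Caccioppoli for `L` on `z`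
and its lattice differences + discrete Sobolev: `sup_{B_{R/8}} |Dz|² ≲ R⁻⁵ · oscAt S z c R m`). [folklore] -/
def InteriorProp (κ C : ℝ) : Prop :=
  ∀ (t : Fin 2 → EuclideanSpace ℝ (Fin 3)) (A : EuclideanSpace ℝ (Fin 3) →L[ℝ] EuclideanSpace ℝ (Fin 3)),
    Adm₀ A → Inner₀ t A → PSIneq κ t A →
    ∀ (z b : EuclideanSpace ℝ (Fin 3) → EuclideanSpace ℝ (Fin 3)) (c m : EuclideanSpace ℝ (Fin 3)) (R Y₀ Y₂ : ℝ),
      16 ≤ R → 0 ≤ Y₀ → 0 ≤ Y₂ →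
      (∀ p ∈ Sites₀ t A, ‖z p - m - b p‖ ≤ Y₀) →
      Summable (fun p : Sites₀ t A => ‖b p‖ ^ 2) → (∑' p : Sites₀ t A, ‖b p‖ ^ 2) ≤ Y₂ ^ 2 →
      IsHarmonicOn (Sites₀ t A) z c R →
      ∀ r : ℝ, 1 ≤ r → 16 * r ≤ R →
        ∃ m' : EuclideanSpace ℝ (Fin 3), oscAt (Sites₀ t A) z c r m' ≤
          C * ((r / R) ^ 5 * oscAt (Sites₀ t A) z c R m + r ^ 5 * (Y₀ ^ 2 * (R⁻¹) ^ 8 + Y₂ ^ 2 * (R⁻¹) ^ 11))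

/-- **One step of the blow-down iteration** (output of level 2; parameters `θ ∈ (0,1)`, threshold `R₀`, floor
constant `K`) for a field `v` on a site set `S`: for every centre `c`, radius `R ≥ R₀` and constant `‖m‖ ≤ 1` there
is a constant `‖m'‖ ≤ 1` with the NORMALISED improvement
`(θR)⁻³ · oscAt S v c (θR) m' ≤ ½ · (16R)⁻³ · oscAt S v c (16R) m + K · R⁻⁴`. [folklore] -/
def ImprovementProp (θ R₀ K : ℝ) (S : Set (EuclideanSpace ℝ (Fin 3)))
    (v : EuclideanSpace ℝ (Fin 3) → EuclideanSpace ℝ (Fin 3)) : Prop :=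
  ∀ (c : EuclideanSpace ℝ (Fin 3)) (R : ℝ) (m : EuclideanSpace ℝ (Fin 3)), R₀ ≤ R → ‖m‖ ≤ 1 →
    ∃ m' : EuclideanSpace ℝ (Fin 3), ‖m'‖ ≤ 1 ∧
      ((θ * R)⁻¹) ^ 3 * oscAt S v c (θ * R) m' ≤
        (1 / 2) * (((16 * R)⁻¹) ^ 3 * oscAt S v c (16 * R) m) + K * (R⁻¹) ^ 4

/-! ### Elementary API -/

local notation "E3" => EuclideanSpace ℝ (Fin 3)

/-- Registered sub-goal carrying this vocabulary file (crux stmt-AtomisticToContinuum-9332, line `Sketch`, skeleton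
v4): the truncated remainder is antisymmetric, because the pair-force remainder is odd,
`N(−e, −d) = −N(e, d)`. [folklore] -/
theorem hcpLiouville_blowdown_vocabulary :
    ∀ (v : E3 → E3) (c : E3) (R : ℝ) (p q : E3),
      truncRemainder v c R q p = -truncRemainder v c R p q := by
  intro v c R p q
  have hodd : ∀ e d : E3, ljRemainder (-e) (-d) = -ljRemainder e d := by
    intro e d
    have hF : ∀ x : E3, ljForce (-x) = -ljForce x := fun x => by
      simp [ljForce, norm_neg, smul_neg]
    have hK : forceConst (-e) = forceConst e := by
      ext x i
      simp [forceConst_apply, norm_neg, inner_neg_left, smul_neg, neg_smul]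
    rw [ljRemainder, ljRemainder, ← neg_add, hF, hF, hK, map_neg]
    abel
  unfold truncRemainder
  by_cases h : dist p c ≤ R ∨ dist q c ≤ R
  · rw [if_pos h, if_pos (Or.comm.1 h), show q - p = -(p - q) by abel, show v q - v p = -(v p - v q) by abel,
      hodd]
  · rw [if_neg h, if_neg (fun h' => h (Or.comm.1 h')), neg_zero]

/-- `oscAt` is nonnegative. [folklore] -/
theorem oscAt_nonneg (S : Set E3) (v : E3 → E3) (c : E3) (r : ℝ) (m : E3) : 0 ≤ oscAt S v c r m :=
  tsum_nonneg fun _ => sq_nonneg _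

/-- `nnEnergy` is nonnegative. [folklore] -/
theorem nnEnergy_nonneg (S : Set E3) (v : E3 → E3) (c : E3) (r : ℝ) : 0 ≤ nnEnergy S v c r :=
  tsum_nonneg fun _ => tsum_nonneg fun _ => by split_ifs <;> positivity

/-- The truncated remainder is the remainder whenever the first site lies in the ball. [folklore] -/
theorem truncRemainder_of_dist_le (v : E3 → E3) {c : E3} {R : ℝ} {p : E3} (hp : dist p c ≤ R) (q : E3) :
    truncRemainder v c R p q = ljRemainder (p - q) (v p - v q) := by
  simp [truncRemainder, hp]

/-- `PhononStability` (mirror form) gives `PSIneq κ` at every admissible hcp-like datum. [folklore] -/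
theorem psIneq_of_forall {κ : ℝ}
    (h : ∀ (t : Fin 2 → E3) (A : E3 →L[ℝ] E3), Adm₀ A → Inner₀ t A →
      ∀ u : E3 → E3, (Function.support u).Finite → Function.support u ⊆ Sites₀ t A →
        κ * nnForm t A u ≤ hessForm t A u / 2)
    {t : Fin 2 → E3} {A : E3 →L[ℝ] E3} (hA : Adm₀ A) (hI : Inner₀ t A) : PSIneq κ t A :=
  fun u hu hus => h t A hA hI u hu hus


/-! ### Working form of the interior estimate (appended for skeleton v4, wave 1) -/

/-- **Interior oscillation decay for `L`-harmonic fields, WORKING FORM** (interface; stability constant `κ`, constant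
`C`; this is the form the skeleton's stubs `stub_interior`/`stub_improvement` use — `InteriorProp` above is the sharper
Lipschitz-rate variant, kept for reference): same hypotheses as `InteriorProp`; conclusion with the rate `(r/R)⁴` (any
exponent `> 3` drives the iteration) and the weaker far-field floors `Y₀² R⁻⁶ + Y₂² R⁻⁸` (what the iteration tolerates:
the exterior of the ball acts on the lattice differences of `z` through DIFFERENCES of the kernel, `|∇K| ≲ r⁻⁹`, plus
boundary shells; these floors leave one power of `R` of slack at each of the two difference levels). [folklore] -/
def InteriorDecayProp (κ C : ℝ) : Prop :=
  ∀ (t : Fin 2 → E3) (A : E3 →L[ℝ] E3), Adm₀ A → Inner₀ t A → PSIneq κ t A →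
    ∀ (z b : E3 → E3) (c m : E3) (R Y₀ Y₂ : ℝ), 16 ≤ R → 0 ≤ Y₀ → 0 ≤ Y₂ →
      (∀ p ∈ Sites₀ t A, ‖z p - m - b p‖ ≤ Y₀) →
      Summable (fun p : Sites₀ t A => ‖b p‖ ^ 2) → (∑' p : Sites₀ t A, ‖b p‖ ^ 2) ≤ Y₂ ^ 2 →
      IsHarmonicOn (Sites₀ t A) z c R →
      ∀ r : ℝ, 1 ≤ r → 16 * r ≤ R →
        ∃ m' : E3, oscAt (Sites₀ t A) z c r m' ≤
          C * ((r / R) ^ 4 * oscAt (Sites₀ t A) z c R m + r ^ 5 * (Y₀ ^ 2 * (R⁻¹) ^ 6 + Y₂ ^ 2 * (R⁻¹) ^ 8))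

/-- The sharp interior estimate (with a nonnegative constant) implies the working form:
`(r/R)⁵ ≤ (r/R)⁴`, `R⁻⁸ ≤ R⁻⁶`, `R⁻¹¹ ≤ R⁻⁸` for `16 ≤ R`, `1 ≤ r`, `16 r ≤ R`. [folklore] -/
theorem interiorDecayProp_of_interiorProp {κ C : ℝ} (hC : 0 ≤ C) (h : InteriorProp κ C) :
    InteriorDecayProp κ C := by
  intro t A hA hI hPS z b c m R Y₀ Y₂ hR hY₀ hY₂ ha hb hb2 hz r hr hrR
  obtain ⟨m', hm'⟩ := h t A hA hI hPS z b c m R Y₀ Y₂ hR hY₀ hY₂ ha hb hb2 hz r hr hrR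
  refine ⟨m', hm'.trans ?_⟩
  have hR1 : 1 ≤ R := by linarith
  have hRpos : 0 < R := by linarith
  have hq : 0 ≤ r / R := by positivity
  have hq1 : r / R ≤ 1 := by rw [div_le_one hRpos]; linarith
  have hRi : R⁻¹ ≤ 1 := inv_le_one_of_one_le₀ hR1
  have hRi0 : 0 ≤ R⁻¹ := by positivity
  have h1 : (r / R) ^ 5 ≤ (r / R) ^ 4 := pow_le_pow_of_le_one hq hq1 (by norm_num)
  have h2 : (R⁻¹) ^ 8 ≤ (R⁻¹) ^ 6 := pow_le_pow_of_le_one hRi0 hRi (by norm_num)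
  have h3 : (R⁻¹) ^ 11 ≤ (R⁻¹) ^ 8 := pow_le_pow_of_le_one hRi0 hRi (by norm_num)
  have ho : 0 ≤ oscAt (Sites₀ t A) z c R m := oscAt_nonneg _ _ _ _ _
  have hr0 : 0 ≤ r ^ 5 := by positivity
  gcongr


/-- Registered sub-goal carrying this append (crux stmt-AtomisticToContinuum-9332, line `Sketch`, skeleton v4, wave 1):
the sharp interior estimate with a nonnegative constant implies the working form. [folklore] -/
theorem hcpLiouville_blowdown_workingForm :
    ∀ κ C : ℝ, 0 ≤ C → InteriorProp κ C → InteriorDecayProp κ C :=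
  fun _ _ hC h => interiorDecayProp_of_interiorProp hC h

end Blowdown

end Summit.AtomisticToContinuum.Crystallization.Theorems.ExcessDecayLiouville

end
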